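import Literature.NumberTheory.LFunctions.RayClassCharacterGrowth
import Literature.NumberTheory.LFunctions.DedekindZetaProofs
import Mathlib.NumberTheory.DirichletCharacter.Bounds
import Mathlib.Analysis.Complex.LocallyUniformLimit
import Mathlib.Analysis.Analytic.Uniqueness
import Mathlib.Analysis.Complex.CauchyIntegral
import Mathlib.Analysis.Complex.Convex
import HarnessLib

/-!
# Route `SignedLowerHalves`, crux L `SmallImageLowerHalfBothSigns` (stmt-BirchSwinnertonDyer-23599), line `rtt_w3` v43 — row S4‴ (`stub_junctionRecipValues_ns`), THE MATCH:
# (AN) ANALYTIC CONTINUATION OF THE DEPLETED HECKE `L`-SERIES DOWN TO `re s > 3/2`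

WIDTH seat `bsd-line-slh-p3-w3` g30 under LEAD `cruxlead-stmt-BirchSwinnertonDyer-23599` g15 (cell `bsd-ssimc`). Helper `--supports stmt-BirchSwinnertonDyer-23599`.
THEOREMS ONLY; no definition, no named fact, no instance, no `sorry`.

WHY. THE MATCH (`hval_core`, p827772) shares ONE series predicate `Lser` between the Mazur–Tate side and Kato's value law. Kato's (15.9.1) — the tree's F1 fact read through
`IsDepletedHeckeLIdeal` and honda's bridge `prop159_values_inert_hV_of_isGrossencharakter` (p828846) — pins the admissible continuation `Λ` by
`∀ s, 3/2 < re s → Λ s = Σ_{(I, p𝔣) = 1} ψ(I)·χ(N I)·N I^{−s}`, whereas the Mazur–Tate side produces the entire continuation of `L(g′ ⊗ χ⁻¹, s)`, which agrees with that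
series only on `re s > σ₀ ≥ 2` (`exists_differentiable_eq_twistedLSeries`, `twistedLSeries_conj_eq_rayClassLSeries`). ★★ `eq_depletedSeries_of_eqOn_halfPlane` closes the gap:
an ENTIRE `Λ` agreeing with the depleted series of a character of weight-one growth (`‖ψ(𝔭)‖ ≤ N𝔭^{1/2}` off the modulus) and a Dirichlet character `χ` on SOME right half-plane
agrees with it on `re s > 3/2` — the series converges absolutely and locally uniformly there (`summable_norm_absNorm_cpow` at `re s − 1/2 > 1`,
`Complex.differentiableOn_tsum_of_summable_norm`), so both sides are analytic on the connected half-plane and the identity theorem applies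
(`AnalyticOnNhd.eqOn_of_preconnected_of_eventuallyEq`; same pattern as honda's `eq_twistedLSeries_of_eqOn_halfPlane`).
HONEST FRAMING: classical analysis; S4‴, crux L and BSD remain OPEN. References: [NeukirchANT1999] Ch. VII §8 (8.1); [Shimura1971] Thm. 3.66.
-/

set_option autoImplicit false
set_option linter.dupNamespace false -- D-0017: single-problem summit, the namespace repeats the problem name by design
noncomputable section

open scoped Classical
open NumberField IsDedekindDomain Complex Filter Topology
open Literature.NumberTheory.LFunctions

namespace Summit.BirchSwinnertonDyer.BirchSwinnertonDyer.Theorems.SmallImageRttReciprocity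

variable {K : Type*} [Field K] [NumberField K]

/-- **Termwise bound for the depleted series**: `‖[I ⊥ 𝔠]·ψ(I)·χ(N I)·N I^{−z}‖ ≤ ‖N I^{−(z − 1/2)}‖` under weight-one growth of `ψ` off `𝔠` (`𝔠 ≠ 0, ⊤`).
[cite: NeukirchANT1999, Ch. VII §8 (8.1) Proposition] -/
theorem norm_depletedTerm_le {𝔠 : Ideal (𝓞 K)} (h𝔠 : 𝔠 ≠ ⊥) (h𝔠1 : 𝔠 ≠ ⊤) {ψ : HeightOneSpectrum (𝓞 K) → ℂ}
    (hψ : ∀ v : HeightOneSpectrum (𝓞 K), ¬ 𝔠 ≤ v.asIdeal → ‖ψ v‖ ≤ ‖((Ideal.absNorm v.asIdeal : ℕ) : ℂ) ^ (((1 / 2 : ℝ)) : ℂ)‖)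
    {N : ℕ} [NeZero N] (χ : DirichletCharacter ℂ N) (z : ℂ) (I : Ideal (𝓞 K)) :
    ‖(if IsCoprime I 𝔠 then idealPow K ψ I * χ ((Ideal.absNorm I : ℕ) : ZMod N) * ((Ideal.absNorm I : ℕ) : ℂ) ^ (-z) else 0)‖ ≤
      ‖((Ideal.absNorm I : ℕ) : ℂ) ^ (-(z - ((1 / 2 : ℝ) : ℂ)))‖ := by
  split_ifs with hI
  · have hI0 : I ≠ ⊥ := by
      rintro rfl
      exact h𝔠1 (Ideal.isCoprime_iff_sup_eq.mp hI ▸ by simp)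
    have h := norm_rayClassCoeff_mul_le_of_growth h𝔠 (t := ((1 / 2 : ℝ) : ℂ)) (by norm_num) hψ z I
    have hcoeff : rayClassCoeff 𝔠 ψ I = idealPow K ψ I := by
      unfold rayClassCoeff
      rw [if_pos ⟨hI0, hI⟩]
    rw [hcoeff] at h
    calc ‖idealPow K ψ I * χ ((Ideal.absNorm I : ℕ) : ZMod N) * ((Ideal.absNorm I : ℕ) : ℂ) ^ (-z)‖
        = ‖idealPow K ψ I * ((Ideal.absNorm I : ℕ) : ℂ) ^ (-z)‖ * ‖χ ((Ideal.absNorm I : ℕ) : ZMod N)‖ := by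
          rw [norm_mul, norm_mul, norm_mul]; ring
      _ ≤ ‖idealPow K ψ I * ((Ideal.absNorm I : ℕ) : ℂ) ^ (-z)‖ * 1 :=
          mul_le_mul_of_nonneg_left (DirichletCharacter.norm_le_one χ _) (norm_nonneg _)
      _ ≤ ‖((Ideal.absNorm I : ℕ) : ℂ) ^ (-(z - ((1 / 2 : ℝ) : ℂ)))‖ := by rw [mul_one]; exact h
  · rw [norm_zero]; exact norm_nonneg _

/-- On the half-plane `re z > σ′` the bound `‖N I^{−(z − 1/2)}‖ ≤ ‖N I^{−(σ′ − 1/2)}‖`. [folklore] -/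
theorem norm_absNorm_cpow_neg_le {σ' : ℝ} (hσ' : 1 / 2 < σ') {z : ℂ} (hz : σ' < z.re) (I : Ideal (𝓞 K)) :
    ‖((Ideal.absNorm I : ℕ) : ℂ) ^ (-(z - ((1 / 2 : ℝ) : ℂ)))‖ ≤ ‖((Ideal.absNorm I : ℕ) : ℂ) ^ (-(((σ' : ℝ) : ℂ) - ((1 / 2 : ℝ) : ℂ)))‖ := by
  rcases Nat.eq_zero_or_pos (Ideal.absNorm I) with h0 | hpos
  · have h1 : (-(z - ((1 / 2 : ℝ) : ℂ))) ≠ 0 := by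
      intro h; have := congrArg Complex.re h; simp at this; linarith
    rw [h0, Nat.cast_zero, Complex.zero_cpow h1, norm_zero]
    exact norm_nonneg _
  · rw [Complex.norm_natCast_cpow_of_pos hpos, Complex.norm_natCast_cpow_of_pos hpos]
    refine Real.rpow_le_rpow_of_exponent_le (by exact_mod_cast hpos) ?_
    simp only [Complex.neg_re, Complex.sub_re, Complex.ofReal_re]
    linarith

/-- **The depleted series is holomorphic on `re s > 3/2`** (absolute and locally uniform convergence under weight-one growth). [cite: NeukirchANT1999, Ch. VII §8 (8.1) Proposition] -/
theorem differentiableOn_depletedSeries {𝔠 : Ideal (𝓞 K)} (h𝔠 : 𝔠 ≠ ⊥) (h𝔠1 : 𝔠 ≠ ⊤) {ψ : HeightOneSpectrum (𝓞 K) → ℂ}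
    (hψ : ∀ v : HeightOneSpectrum (𝓞 K), ¬ 𝔠 ≤ v.asIdeal → ‖ψ v‖ ≤ ‖((Ideal.absNorm v.asIdeal : ℕ) : ℂ) ^ (((1 / 2 : ℝ)) : ℂ)‖)
    {N : ℕ} [NeZero N] (χ : DirichletCharacter ℂ N) {σ' : ℝ} (hσ' : 3 / 2 < σ') :
    DifferentiableOn ℂ (fun z : ℂ ↦ ∑' I : Ideal (𝓞 K),
      (if IsCoprime I 𝔠 then idealPow K ψ I * χ ((Ideal.absNorm I : ℕ) : ZMod N) * ((Ideal.absNorm I : ℕ) : ℂ) ^ (-z) else 0)) {z : ℂ | σ' < z.re} := by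
  have hU : IsOpen {z : ℂ | σ' < z.re} := isOpen_lt continuous_const Complex.continuous_re
  have hsum : Summable fun I : Ideal (𝓞 K) ↦ ‖((Ideal.absNorm I : ℕ) : ℂ) ^ (-(((σ' : ℝ) : ℂ) - ((1 / 2 : ℝ) : ℂ)))‖ :=
    summable_norm_absNorm_cpow K (s := ((σ' : ℝ) : ℂ) - ((1 / 2 : ℝ) : ℂ)) (by simp only [Complex.sub_re, Complex.ofReal_re]; linarith)
  refine Complex.differentiableOn_tsum_of_summable_norm hsum (fun I ↦ ?_) hU fun I z hz ↦
    (norm_depletedTerm_le h𝔠 h𝔠1 hψ χ z I).trans (norm_absNorm_cpow_neg_le (by linarith) hz I)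
  -- each term is entire
  by_cases hI : IsCoprime I 𝔠
  · simp only [if_pos hI]
    have hI0 : I ≠ ⊥ := by
      rintro rfl
      exact h𝔠1 (Ideal.isCoprime_iff_sup_eq.mp hI ▸ by simp)
    have hN0 : ((Ideal.absNorm I : ℕ) : ℂ) ≠ 0 := by exact_mod_cast (Ideal.absNorm_eq_zero_iff.not.mpr hI0)
    intro z _
    exact ((differentiableAt_id.neg.const_cpow (Or.inl hN0)).const_mul _).differentiableWithinAt
  · simp only [if_neg hI]
    exact differentiableOn_const 0

/-- ★★ **(AN) Analytic continuation to `re s > 3/2`**: an entire `Λ` that agrees with the depleted series `Σ_{(I,𝔠)=1} ψ(I)·χ(N I)·N I^{−s}` on some right half-plane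
agrees with it on `re s > 3/2` (identity theorem on the connected half-plane where the series is holomorphic). [cite: NeukirchANT1999, Ch. VII §8 (8.1) Proposition]
[cite: Shimura1971, Thm. 3.66] -/
theorem eq_depletedSeries_of_eqOn_halfPlane {𝔠 : Ideal (𝓞 K)} (h𝔠 : 𝔠 ≠ ⊥) (h𝔠1 : 𝔠 ≠ ⊤) {ψ : HeightOneSpectrum (𝓞 K) → ℂ}
    (hψ : ∀ v : HeightOneSpectrum (𝓞 K), ¬ 𝔠 ≤ v.asIdeal → ‖ψ v‖ ≤ ‖((Ideal.absNorm v.asIdeal : ℕ) : ℂ) ^ (((1 / 2 : ℝ)) : ℂ)‖)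
    {N : ℕ} [NeZero N] (χ : DirichletCharacter ℂ N) {Λ : ℂ → ℂ} (hΛ : Differentiable ℂ Λ) {σ₁ : ℝ}
    (h : ∀ s : ℂ, σ₁ < s.re → Λ s = ∑' I : Ideal (𝓞 K),
      (if IsCoprime I 𝔠 then idealPow K ψ I * χ ((Ideal.absNorm I : ℕ) : ZMod N) * ((Ideal.absNorm I : ℕ) : ℂ) ^ (-s) else 0))
    (s : ℂ) (hs : 3 / 2 < s.re) :
    Λ s = ∑' I : Ideal (𝓞 K), (if IsCoprime I 𝔠 then idealPow K ψ I * χ ((Ideal.absNorm I : ℕ) : ZMod N) * ((Ideal.absNorm I : ℕ) : ℂ) ^ (-s) else 0) := by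
  set G : ℂ → ℂ := fun z ↦ ∑' I : Ideal (𝓞 K),
    (if IsCoprime I 𝔠 then idealPow K ψ I * χ ((Ideal.absNorm I : ℕ) : ZMod N) * ((Ideal.absNorm I : ℕ) : ℂ) ^ (-z) else 0) with hG
  have hU : IsOpen {z : ℂ | (3 / 2 : ℝ) < z.re} := isOpen_lt continuous_const Complex.continuous_re
  have hUc : IsPreconnected {z : ℂ | (3 / 2 : ℝ) < z.re} := (convex_halfSpace_re_gt (3 / 2)).isPreconnected
  have hGa : AnalyticOnNhd ℂ G {z : ℂ | (3 / 2 : ℝ) < z.re} := by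
    intro z hz
    have hσ' : (3 : ℝ) / 2 < (3 / 2 + z.re) / 2 := by simp only [Set.mem_setOf_eq] at hz; linarith
    have hU' : IsOpen {w : ℂ | (3 / 2 + z.re) / 2 < w.re} := isOpen_lt continuous_const Complex.continuous_re
    have hz' : z ∈ {w : ℂ | (3 / 2 + z.re) / 2 < w.re} := by simp only [Set.mem_setOf_eq] at hz ⊢; linarith
    exact (differentiableOn_depletedSeries h𝔠 h𝔠1 hψ χ hσ').analyticAt (hU'.mem_nhds hz')
  have hΛa : AnalyticOnNhd ℂ Λ {z : ℂ | (3 / 2 : ℝ) < z.re} := hΛ.differentiableOn.analyticOnNhd hU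
  have hz₀ : ((max σ₁ 2 + 1 : ℝ) : ℂ) ∈ {z : ℂ | (3 / 2 : ℝ) < z.re} := by
    simp only [Set.mem_setOf_eq, Complex.ofReal_re]
    linarith [le_max_right σ₁ 2]
  have hev : Λ =ᶠ[𝓝 ((max σ₁ 2 + 1 : ℝ) : ℂ)] G := by
    have hO : IsOpen {z : ℂ | σ₁ < z.re} := isOpen_lt continuous_const Complex.continuous_re
    refine Filter.eventually_of_mem (hO.mem_nhds ?_) fun z hz ↦ h z hz
    simp only [Set.mem_setOf_eq, Complex.ofReal_re]
    linarith [le_max_left σ₁ 2]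
  exact hΛa.eqOn_of_preconnected_of_eventuallyEq hGa hUc hz₀ hev hs

end Summit.BirchSwinnertonDyer.BirchSwinnertonDyer.Theorems.SmallImageRttReciprocity

end
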